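import Mathlib
import Literature.NumberTheory.Transcendental.KZHomotopyMoves
import Literature.NumberTheory.Transcendental.KZLogCalculusProofs
import Literature.NumberTheory.Transcendental.KZDominatedFamilyRelations
import Literature.NumberTheory.Transcendental.KZMonomialCompression
import Literature.NumberTheory.Transcendental.KZSemialgebraicComplex
import Literature.NumberTheory.Transcendental.KZIntervalPeriodProofs
import Literature.NumberTheory.Transcendental.SemialgebraicMapsProofs

/-!
# Route `ComplexOrientations`, support item `CauchyMove` (stmt-KontsevichZagierPeriods-11370):
# the Cauchy move, part D1 — the closed disc and analysis on it

Helper file (prover-owned, `--supports CauchyMove`). The item `CauchyMove` asks that, for `g`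
holomorphic on `‖t‖ < R` and algebraic over `ℚ(t)` and `0 < ρ < R` real algebraic, the
representation `[ℝ, s ↦ Re (g(γ s) γ'(s))]` (`γ(s) = ρ(1 + is)/(1 − is)` the rational
parametrisation of `‖t‖ = ρ`) lie in `KZ.relations`. The chain is Green's theorem on the closed
disc `D = {x₀² + x₁² ≤ ρ²}` realised by the printed rules of Kontsevich–Zagier: Newton–Leibniz
along the last coordinate with primitives `Re g`, `Im g` (rule (3)), a coordinate swap (rule (2)),
the Cauchy–Riemann cancellation (rule (1b)), and one-variable substitutions matching the boundary
of `D` with the parametrised circle (rules (2), (1a), (1b)).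

This file: the base interval `τ = {u² ≤ ρ²}`, the edges `±√(ρ² − u²)` and the disc as a
`KZlog.band` (`band_eq_disc`), their `ℚ`-semialgebraicity for real algebraic `ρ` and compactness;
continuity of `g` on the disc and the fibre derivatives `∂_t Re g(u + it) = −Im g'`,
`∂_t Im g(t + iv) = Im g'` (`hasDerivAt_re_vertical`, `hasDerivAt_im_horizontal`). No definitions
(points of `ℝ²` are read in `ℂ` through the local notations `cx x = x₀ + i x₁`,
`cxs x = x₁ + i x₀`).

Sources: M. Kontsevich, D. Zagier, *Periods* (2001), §1.2 (rules (1)–(3)). Fully proved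
([folklore]).
-/

noncomputable section

open MvPolynomial Set Metric MeasureTheory
open Literature.ModelTheory.ExponentialFields Literature.NumberTheory.Transcendental
open Literature.NumberTheory.Transcendental.KZ

namespace Summit.KontsevichZagierPeriods.ComplexOrientations.CauchyMoveAux

/-- The complex number `x₀ + i x₁` attached to a point `x ∈ ℝ²` (local notation). -/
local notation:max "cx " x:max => (Complex.mk (x 0) (x 1))

/-- The complex number `x₁ + i x₀` attached to a point `x ∈ ℝ²` (swapped; local notation). -/
local notation:max "cxs " x:max => (Complex.mk (x 1) (x 0))

variable {ρ : ℝ}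

/-! ### The closed disc, its base interval and its edges -/

/-- `(Fin.snoc u t) 0 = u 0` on `ℝ²`. [folklore] -/
@[simp] theorem snoc_zero (u : Fin 1 → ℝ) (t : ℝ) : (Fin.snoc u t : Fin 2 → ℝ) 0 = u 0 := rfl
/-- `(Fin.snoc u t) 1 = t` on `ℝ²`. [folklore] -/
@[simp] theorem snoc_one (u : Fin 1 → ℝ) (t : ℝ) : (Fin.snoc u t : Fin 2 → ℝ) 1 = t := rfl
/-- `(Fin.init z) 0 = z 0` on `ℝ²`. [folklore] -/
@[simp] theorem init_zero (z : Fin 2 → ℝ) : (Fin.init z : Fin 1 → ℝ) 0 = z 0 := rfl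

/-- The base interval `τ = {u | u² ≤ ρ²}` is `ℚ`-semialgebraic for real algebraic `ρ`. -/
theorem isSemialgebraic_tau (hρ : IsAlgebraic ℚ ρ) :
    IsSemialgebraic ℚ {u : Fin 1 → ℝ | u 0 ^ 2 ≤ ρ ^ 2} := by
  have h1 : IsSemialgebraicFunOn ℚ (univ : Set (Fin 1 → ℝ)) (fun u => ρ ^ 2 - u 0 ^ 2) :=
    IsSemialgebraicFunOn.sub_holds (isSemialgebraicFunOn_const_of_isAlgebraic isSemialgebraic_univ
      (hρ.pow 2)) ((isSemialgebraicFunOn_aeval isSemialgebraic_univ (X 0 ^ 2)).congr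
        fun u _ => by simp)
  convert h1.isSemialgebraic_sep_nonneg using 1
  ext u; simp [sub_nonneg]

/-- The closed disc `D = {x | x₀² + x₁² ≤ ρ²}` is `ℚ`-semialgebraic for real algebraic `ρ`. -/
theorem isSemialgebraic_disc (hρ : IsAlgebraic ℚ ρ) :
    IsSemialgebraic ℚ {x : Fin 2 → ℝ | x 0 ^ 2 + x 1 ^ 2 ≤ ρ ^ 2} := by
  have h1 : IsSemialgebraicFunOn ℚ (univ : Set (Fin 2 → ℝ)) (fun x => ρ ^ 2 - (x 0 ^ 2 + x 1 ^ 2)) :=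
    IsSemialgebraicFunOn.sub_holds (isSemialgebraicFunOn_const_of_isAlgebraic isSemialgebraic_univ
      (hρ.pow 2)) ((isSemialgebraicFunOn_aeval isSemialgebraic_univ (X 0 ^ 2 + X 1 ^ 2)).congr
        fun u _ => by simp)
  convert h1.isSemialgebraic_sep_nonneg using 1
  ext u; simp [sub_nonneg]

/-- The upper edge `b(u) = √(ρ² − u²)` is `ℚ`-semialgebraic on `τ`. -/
theorem isSemialgebraicFunOn_b (hρ : IsAlgebraic ℚ ρ) :
    IsSemialgebraicFunOn ℚ {u : Fin 1 → ℝ | u 0 ^ 2 ≤ ρ ^ 2} (fun u => √(ρ ^ 2 - u 0 ^ 2)) := by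
  have hτ := isSemialgebraic_tau hρ
  exact IsSemialgebraicFunOn.sqrt_holds (IsSemialgebraicFunOn.sub_holds
    (isSemialgebraicFunOn_const_of_isAlgebraic hτ (hρ.pow 2))
    ((isSemialgebraicFunOn_aeval hτ (X 0 ^ 2)).congr fun u _ => by simp))

/-- The lower edge `a(u) = -√(ρ² − u²)` is `ℚ`-semialgebraic on `τ`. -/
theorem isSemialgebraicFunOn_a (hρ : IsAlgebraic ℚ ρ) :
    IsSemialgebraicFunOn ℚ {u : Fin 1 → ℝ | u 0 ^ 2 ≤ ρ ^ 2} (fun u => -√(ρ ^ 2 - u 0 ^ 2)) :=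
  (isSemialgebraicFunOn_b hρ).neg

/-- The disc is the band between the two edges over `τ`. -/
theorem band_eq_disc (ρ : ℝ) :
    KZlog.band {u : Fin 1 → ℝ | u 0 ^ 2 ≤ ρ ^ 2} (fun u => -√(ρ ^ 2 - u 0 ^ 2))
      (fun u => √(ρ ^ 2 - u 0 ^ 2)) = {x : Fin 2 → ℝ | x 0 ^ 2 + x 1 ^ 2 ≤ ρ ^ 2} := by
  ext x
  simp only [KZlog.mem_band, mem_setOf_eq, init_zero]
  rw [show Fin.last 1 = (1 : Fin 2) from rfl]
  constructor
  · rintro ⟨h0, h1, h2⟩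
    have hs : 0 ≤ ρ ^ 2 - x 0 ^ 2 := by linarith
    have hab : |x 1| ≤ √(ρ ^ 2 - x 0 ^ 2) := abs_le.2 ⟨h1, h2⟩
    have h3 : |x 1| ^ 2 ≤ √(ρ ^ 2 - x 0 ^ 2) ^ 2 := pow_le_pow_left₀ (abs_nonneg _) hab 2
    rw [Real.sq_sqrt hs, sq_abs] at h3
    linarith
  · intro h
    have hs : 0 ≤ ρ ^ 2 - x 0 ^ 2 := by nlinarith [sq_nonneg (x 1)]
    have hab : |x 1| ≤ √(ρ ^ 2 - x 0 ^ 2) := by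
      rw [← Real.sqrt_sq_eq_abs]
      exact Real.sqrt_le_sqrt (by linarith)
    exact ⟨by nlinarith [sq_nonneg (x 1)], (abs_le.1 hab).1, (abs_le.1 hab).2⟩

/-- Points of the closed disc of radius `ρ` lie in the open disc of any radius `R' > ρ`. -/
theorem cx_mem_ball_of_mem_disc (hρ : 0 < ρ) {R' : ℝ} (hR : ρ < R') {x : Fin 2 → ℝ}
    (hx : x 0 ^ 2 + x 1 ^ 2 ≤ ρ ^ 2) : cx x ∈ ball (0 : ℂ) R' := by
  rw [mem_ball, dist_zero_right]
  have h1 : ‖cx x‖ ^ 2 ≤ ρ ^ 2 := by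
    rw [Complex.sq_norm, Complex.normSq_mk]; nlinarith
  have h2 : ‖cx x‖ ≤ ρ := by
    nlinarith [norm_nonneg (cx x), sq_nonneg (‖cx x‖ - ρ), sq_nonneg (‖cx x‖ + ρ)]
  linarith

/-- Same for the swapped identification. -/
theorem cxs_mem_ball_of_mem_disc (hρ : 0 < ρ) {R' : ℝ} (hR : ρ < R') {x : Fin 2 → ℝ}
    (hx : x 0 ^ 2 + x 1 ^ 2 ≤ ρ ^ 2) : cxs x ∈ ball (0 : ℂ) R' :=
  cx_mem_ball_of_mem_disc (x := ![x 1, x 0]) hρ hR (by simp; linarith)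

/-- The closed disc is compact. -/
theorem isCompact_disc (ρ : ℝ) : IsCompact {x : Fin 2 → ℝ | x 0 ^ 2 + x 1 ^ 2 ≤ ρ ^ 2} := by
  refine Metric.isCompact_of_isClosed_isBounded ?_ ?_
  · exact isClosed_le ((continuous_apply 0).pow 2 |>.add ((continuous_apply 1).pow 2))
      continuous_const
  · refine (Metric.isBounded_iff_subset_closedBall 0).2 ⟨|ρ|, fun x hx => ?_⟩
    rw [mem_closedBall, dist_zero_right, pi_norm_le_iff_of_nonneg (abs_nonneg ρ)]
    intro i
    rw [Real.norm_eq_abs, ← sq_le_sq]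
    have : x 0 ^ 2 + x 1 ^ 2 ≤ ρ ^ 2 := hx
    fin_cases i <;> simp <;> nlinarith [sq_nonneg (x 0), sq_nonneg (x 1)]

/-- The base interval is compact. -/
theorem isCompact_tau (ρ : ℝ) : IsCompact {u : Fin 1 → ℝ | u 0 ^ 2 ≤ ρ ^ 2} := by
  refine Metric.isCompact_of_isClosed_isBounded ?_ ?_
  · exact isClosed_le ((continuous_apply 0).pow 2) continuous_const
  · refine (Metric.isBounded_iff_subset_closedBall 0).2 ⟨|ρ|, fun x hx => ?_⟩
    rw [mem_closedBall, dist_zero_right, pi_norm_le_iff_of_nonneg (abs_nonneg ρ)]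
    intro i
    rw [Real.norm_eq_abs, ← sq_le_sq, Subsingleton.elim i 0]
    exact hx


/-! ### Analysis on the disc -/

variable {R' : ℝ} {g : ℂ → ℂ}

/-- `x ↦ g (x₀ + i x₁)` is continuous on the closed disc. -/
theorem continuousOn_g_cx (hρ : 0 < ρ) (hR : ρ < R') (hg : DifferentiableOn ℂ g (ball 0 R')) :
    ContinuousOn (fun x : Fin 2 → ℝ => g (cx x)) {x | x 0 ^ 2 + x 1 ^ 2 ≤ ρ ^ 2} := by
  have hc : Continuous fun x : Fin 2 → ℝ => cx x := by
    have : (fun x : Fin 2 → ℝ => cx x) = fun x => Complex.equivRealProdCLM.symm (x 0, x 1) := by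
      funext x; apply Complex.ext <;> simp
    rw [this]
    exact Complex.equivRealProdCLM.symm.continuous.comp
      ((continuous_apply 0).prodMk (continuous_apply 1))
  exact hg.continuousOn.comp hc.continuousOn fun x hx => cx_mem_ball_of_mem_disc hρ hR hx

/-- `x ↦ g (x₁ + i x₀)` is continuous on the closed disc. -/
theorem continuousOn_g_cxs (hρ : 0 < ρ) (hR : ρ < R') (hg : DifferentiableOn ℂ g (ball 0 R')) :
    ContinuousOn (fun x : Fin 2 → ℝ => g (cxs x)) {x | x 0 ^ 2 + x 1 ^ 2 ≤ ρ ^ 2} := by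
  have hc : Continuous fun x : Fin 2 → ℝ => cxs x := by
    have : (fun x : Fin 2 → ℝ => cxs x) = fun x => Complex.equivRealProdCLM.symm (x 1, x 0) := by
      funext x; apply Complex.ext <;> simp
    rw [this]
    exact Complex.equivRealProdCLM.symm.continuous.comp
      ((continuous_apply 1).prodMk (continuous_apply 0))
  exact hg.continuousOn.comp hc.continuousOn fun x hx => cxs_mem_ball_of_mem_disc hρ hR hx

/-- Vertical derivative of `Re g`: `∂/∂t Re g(u + i t) = -Im g'(u + i t)`. -/
theorem hasDerivAt_re_vertical (hg : DifferentiableOn ℂ g (ball 0 R')) (u t : ℝ)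
    (h : (⟨u, t⟩ : ℂ) ∈ ball (0 : ℂ) R') :
    HasDerivAt (fun t : ℝ => (g ⟨u, t⟩).re) (-(deriv g ⟨u, t⟩).im) t := by
  set e : ℂ → ℂ := fun ζ => g (u + Complex.I * ζ) with he
  have hpt : (u : ℂ) + Complex.I * (t : ℂ) = ⟨u, t⟩ := by
    apply Complex.ext <;> simp
  have hgd : HasDerivAt g (deriv g ⟨u, t⟩) ((u : ℂ) + Complex.I * (t : ℂ)) := by
    rw [hpt]; exact (hg.differentiableAt (isOpen_ball.mem_nhds h)).hasDerivAt
  have hlin : HasDerivAt (fun ζ : ℂ => (u : ℂ) + Complex.I * ζ) (Complex.I * 1) (t : ℂ) :=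
    ((hasDerivAt_id (t : ℂ)).const_mul Complex.I).const_add (u : ℂ)
  have he' : HasDerivAt e (deriv g ⟨u, t⟩ * (Complex.I * 1)) (t : ℂ) := hgd.comp (t : ℂ) hlin
  have hre := he'.real_of_complex
  have hfun : (fun x : ℝ => (e (x : ℂ)).re) = fun t : ℝ => (g ⟨u, t⟩).re := by
    funext x
    simp only [he]
    congr 2
    apply Complex.ext <;> simp
  rw [hfun] at hre
  convert hre using 1
  simp

/-- Horizontal derivative of `Im g`: `∂/∂t Im g(t + i v) = Im g'(t + i v)`. -/
theorem hasDerivAt_im_horizontal (hg : DifferentiableOn ℂ g (ball 0 R')) (v t : ℝ)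
    (h : (⟨t, v⟩ : ℂ) ∈ ball (0 : ℂ) R') :
    HasDerivAt (fun t : ℝ => (g ⟨t, v⟩).im) ((deriv g ⟨t, v⟩).im) t := by
  set e : ℂ → ℂ := fun ζ => -Complex.I * g (ζ + Complex.I * v) with he
  have hpt : (t : ℂ) + Complex.I * (v : ℂ) = ⟨t, v⟩ := by
    apply Complex.ext <;> simp
  have hgd : HasDerivAt g (deriv g ⟨t, v⟩) ((t : ℂ) + Complex.I * (v : ℂ)) := by
    rw [hpt]; exact (hg.differentiableAt (isOpen_ball.mem_nhds h)).hasDerivAt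
  have hlin : HasDerivAt (fun ζ : ℂ => ζ + Complex.I * v) 1 (t : ℂ) :=
    (hasDerivAt_id (t : ℂ)).add_const _
  have he' : HasDerivAt e (-Complex.I * (deriv g ⟨t, v⟩ * 1)) (t : ℂ) :=
    (hgd.comp (t : ℂ) hlin).const_mul _
  have hre := he'.real_of_complex
  have hfun : (fun x : ℝ => (e (x : ℂ)).re) = fun t : ℝ => (g ⟨t, v⟩).im := by
    funext x
    simp only [he]
    have : (x : ℂ) + Complex.I * (v : ℂ) = ⟨x, v⟩ := by apply Complex.ext <;> simp
    rw [this]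
    simp
  rw [hfun] at hre
  convert hre using 1
  simp

end Summit.KontsevichZagierPeriods.ComplexOrientations.CauchyMoveAux
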